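import Summits.ABC.ABC.Theorems.DefiniteXiXiBoundUpgrade
import Summits.ABC.ABC.Theorems.DefiniteXiPolyFreyDegree
import Summits.ABC.ABC.Theorems.DefiniteXiPolyDegreeToPolyABC
import Summits.ABC.ABC.Theorems.DefiniteXiXiStrongBoundValuationProductBound
import HarnessLib

/-!
# Route DefiniteXi — support item `XiBoundUpgrade` (stmt-ABC-14722), II (section (H)): the residual is a
# pure exponent sharpening of the congruence number `ξ`; the level-lowering factor is not load-bearing

Companion of `Summits/ABC/ABC/Theorems/DefiniteXiXiBoundUpgrade.lean` ((A)–(E), (G)), written against route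
rev 12 (2026-08-16T07:30Z: `FreyValuationBound` is no longer a route item, so the valuation input
`v_q(Δ_min) ≤ K N^B` is spelled out, exactly as in `polyFreyDegree_of_xiBound_of_valuationBound`).
Item `XiBoundUpgrade := XiBound → XiStrongBound` relates the weak rung
`XiBound : ∃ A C, ξ(E_{a,b}; N/N⁻, N⁻) ≤ C N^A` (stmt-ABC-11336) to the strong rung
`XiStrongBound : ∀ ε, ξ · ∏_{q ∣ N⁻} v_q(Δ_min) ≤ C_ε N^{2+ε}` (stmt-ABC-11337).  This file proves:

* **(H)** The level-lowering factor is NOT load-bearing relative to the weak rung.  `PolyFreyDegree`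
  (stmt-ABC-2026; it follows from `XiBound`, the KNOWN items `DefiniteRTControlPrime` (Takahashi 2001),
  `FreyModularity` (Wiles/BCDT) and the known valuation input `v_q(Δ_min) ≤ K N^B` (Stewart–Tijdeman) by the
  landed `polyFreyDegree_of_xiBound_of_valuationBound`) gives a
  polynomial abc inequality (landed, unconditional: `polyDegreeToPolyABC_proof`), hence polynomial Szpiro
  `|ab(a+b)| ≤ C'³ (2N)^{3κ}` on Frey pairs (`natAbs_le_of_polyAbc`, signs rearranged into an abc triple),
  hence — the valuation product of an integer being sub-polynomial (`stub_valuationProductBound`) and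
  `v_q(Δ_min) ≤ 2 v_q(ab(a+b)) = v_q((ab(a+b))²)` at odd `q` — for every `ε > 0`:
  `∏_{q ∣ N⁻} v_q(Δ_min(E_{a,b})) ≤ C_ε N^ε` for all odd `N⁻`
  (`prod_factorization_le_rpow_of_polyFreyDegree`).  Consequences:
  - `xiStrongBound_iff_xiSharpBound_of_polyFreyDegree` / `xiStrongBound_iff_xiSharpBound`: given
    `PolyFreyDegree` (resp. the three known inputs) the r4 crux `XiStrongBound` is EQUIVALENT to the
    product-free SHARP ξ-BOUND `∀ ε ∃ C, ξ(E; N/N⁻, N⁻) ≤ C N^{2+ε}` — Pasten's product theorem and the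
    `∏ v_q` bookkeeping can be dropped from the crux;
  - `xiBoundUpgrade_iff_xiSharpening`: given the three known inputs, the item `XiBoundUpgrade` is
    LITERALLY "`ξ ≤ C N^A` for some `A` ⟹ `ξ ≤ C_ε N^{2+ε}` for every `ε`" — the exponent sharpening of the
    congruence number alone (abc-strength; Masser 1990 forces `A ≥ 2`).

No new definitions (the sharp ξ-bound is written inline); no named-fact hypotheses (the hypotheses are the route
ITEMS `PolyFreyDegree`, `DefiniteRTControlPrime`, `FreyModularity` and the inline valuation bound).

## References

* D. W. Masser, *Note on a conjecture of Szpiro*, Astérisque 183 (1990).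
* G. Frey, *On ternary equations of Fermat type and relations with elliptic curves* (1997), §3 Cor. 3.1;
  M. R. Murty, *Bounds for congruence primes* (1999), §2 — polynomial degree ⟹ polynomial abc.
* H. Pasten, *Shimura curves and the abc conjecture*, J. Number Theory 254 (2024), Thm 16.8.
-/

-- Summit.<Summit>.<Problem> is the mandated namespace; for the single-conjunct summit ABC the duplicate ABC.ABC is deliberate.
set_option linter.dupNamespace false

noncomputable section

namespace Summit.ABC.ABC.Theorems.DefiniteXiXiBoundUpgradeSharpening

open Literature.NumberTheory
open Literature.NumberTheory.Automorphic
open Literature.NumberTheory.EllipticCurves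
open Literature.NumberTheory.DiophantineGeometry
open Summit.ABC.ABC.Theses.DefiniteXi
open UniqueFactorizationMonoid

/-! ## (H) The level-lowering factor is not load-bearing: reduction to the sharp `ξ`-bound -/

/-- **Polynomial abc for signed pairs.**  A polynomial abc inequality `c ≤ C · rad(abc)^κ` on abc triples
gives, for coprime integers `a, b` with `ab(a+b) ≠ 0`,
`|ab(a+b)| ≤ max(C,0)³ · rad|ab(a+b)|^{3 max(κ,0)}`: rearrange signs so that two of `|a|, |b|, |a+b|`
add up to the third (an abc triple with the same radical) and use `|ab(a+b)| ≤ c³`, `rad ≥ 1`. [folklore] -/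
theorem natAbs_le_of_polyAbc {κ C : ℝ}
    (h : ∀ a b c : ℕ, IsABCTriple a b c → (c : ℝ) ≤ C * ((rad a b c : ℕ) : ℝ) ^ κ)
    {a b : ℤ} (hab : IsCoprime a b) (h0 : a * b * (a + b) ≠ 0) :
    ((a * b * (a + b)).natAbs : ℝ) ≤
      max C 0 ^ 3 * ((radical (a * b * (a + b)).natAbs : ℕ) : ℝ) ^ (3 * max κ 0) := by
  -- the bound for an abc triple `(m, n, m + n)`
  have key : ∀ m n k : ℕ, 0 < m → 0 < n → m + n = k → Nat.Coprime m n →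
      ((m * n * k : ℕ) : ℝ) ≤ max C 0 ^ 3 * ((radical (m * n * k) : ℕ) : ℝ) ^ (3 * max κ 0) := by
    intro m n k hm hn hk hmn
    have hc := h m n k ⟨hm, hn, hk, hmn⟩
    rw [rad_def] at hc
    set R : ℝ := ((radical (m * n * k) : ℕ) : ℝ) with hR
    have hR1 : (1 : ℝ) ≤ R := by
      rw [hR, Nat.one_le_cast, Nat.one_le_iff_ne_zero]
      exact radical_ne_zero
    have hR0 : (0 : ℝ) ≤ R := zero_le_one.trans hR1
    have hk' : (k : ℝ) ≤ max C 0 * R ^ (max κ 0) :=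
      calc (k : ℝ) ≤ C * R ^ κ := hc
        _ ≤ max C 0 * R ^ κ := mul_le_mul_of_nonneg_right (le_max_left _ _) (Real.rpow_nonneg hR0 _)
        _ ≤ max C 0 * R ^ (max κ 0) :=
            mul_le_mul_of_nonneg_left (Real.rpow_le_rpow_of_exponent_le hR1 (le_max_left _ _))
              (le_max_right _ _)
    have hle : m * n * k ≤ k ^ 3 := by
      have hmk : m ≤ k := by omega
      have hnk : n ≤ k := by omega
      calc m * n * k ≤ k * k * k := by gcongr
        _ = k ^ 3 := by ring
    have hleR : ((m * n * k : ℕ) : ℝ) ≤ (k : ℝ) ^ 3 := by exact_mod_cast hle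
    have hk0 : (0 : ℝ) ≤ (k : ℝ) := Nat.cast_nonneg k
    calc ((m * n * k : ℕ) : ℝ) ≤ (k : ℝ) ^ 3 := hleR
      _ ≤ (max C 0 * R ^ (max κ 0)) ^ 3 := pow_le_pow_left₀ hk0 hk' 3
      _ = max C 0 ^ 3 * (R ^ (max κ 0)) ^ 3 := mul_pow _ _ 3
      _ = max C 0 ^ 3 * R ^ (3 * max κ 0) := by
          rw [← Real.rpow_natCast (R ^ max κ 0) 3, ← Real.rpow_mul hR0, mul_comm (max κ 0)]
          norm_num
  -- the three arrangements of signs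
  have hA : a ≠ 0 := fun h ↦ h0 (by rw [h]; ring)
  have hB : b ≠ 0 := fun h ↦ h0 (by rw [h]; ring)
  have hD : a + b ≠ 0 := fun h ↦ h0 (by rw [h]; ring)
  set x := a.natAbs with hx
  set y := b.natAbs with hy
  set z := (a + b).natAbs with hz
  have hx0 : 0 < x := Int.natAbs_pos.mpr hA
  have hy0 : 0 < y := Int.natAbs_pos.mpr hB
  have hz0 : 0 < z := Int.natAbs_pos.mpr hD
  have hprod : (a * b * (a + b)).natAbs = x * y * z := by simp [hx, hy, hz, Int.natAbs_mul]
  rw [hprod]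
  have cop : ∀ {M N : ℤ}, IsCoprime M N → Nat.Coprime M.natAbs N.natAbs := by
    intro M N h
    rw [Nat.Coprime, ← Int.gcd_eq_natAbs]
    exact Int.isCoprime_iff_gcd_eq_one.mp h
  have hAD : IsCoprime a (a + b) := by
    obtain ⟨u, w, huw⟩ := hab
    exact ⟨u - w, w, by linear_combination huw⟩
  have hBD : IsCoprime b (a + b) := by
    obtain ⟨u, w, huw⟩ := hab
    exact ⟨w - u, u, by linear_combination huw⟩
  have hcases : x + y = z ∨ x + z = y ∨ y + z = x := by omega
  rcases hcases with h | h | h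
  · exact key x y z hx0 hy0 h (cop hab)
  · have h1 := key x z y hx0 hz0 h (cop hAD)
    rwa [show x * z * y = x * y * z by ring] at h1
  · have h1 := key y z x hy0 hz0 h (cop hBD)
    rwa [show y * z * x = x * y * z by ring] at h1

/-- **Polynomial Szpiro input on Frey pairs from `PolyFreyDegree`.**  `PolyFreyDegree` gives a polynomial
abc inequality (`polyDegreeToPolyABC_proof`, unconditional), hence absolute `K ≥ 0`, `M ≥ 0` with
`|ab(a+b)| ≤ M · N^K` for all coprime `a, b` (`ab(a+b) ≠ 0`), `N` the conductor of `E_{a,b}`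
(`natAbs_le_of_polyAbc` and `rad|ab(a+b)| ≤ 2N`, `radical_natAbs_dvd_two_mul_conductorNorm_freyCurve`).
[folklore] -/
theorem natAbs_le_rpow_conductor_of_polyFreyDegree (hP : PolyFreyDegree) :
    ∃ K M : ℝ, 0 ≤ K ∧ 0 ≤ M ∧ ∀ a b : ℤ, IsCoprime a b → a * b * (a + b) ≠ 0 → ∀ (N : ℕ) [NeZero N],
      (freyCurve a b).conductorNorm ℤ = N → ((a * b * (a + b)).natAbs : ℝ) ≤ M * (N : ℝ) ^ K := by
  obtain ⟨κ, C, hC⟩ := polyDegreeToPolyABC_proof hP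
  refine ⟨3 * max κ 0, max C 0 ^ 3 * (2 : ℝ) ^ (3 * max κ 0), by positivity, by positivity,
    fun a b hab h0 N _ hN => ?_⟩
  have h1 := natAbs_le_of_polyAbc hC hab h0
  have hκ0 : 0 ≤ 3 * max κ 0 := by positivity
  -- `rad|ab(a+b)| ≤ 2N`
  have hdvd := radical_natAbs_dvd_two_mul_conductorNorm_freyCurve hab h0
  rw [hN] at hdvd
  have hRle : ((radical (a * b * (a + b)).natAbs : ℕ) : ℝ) ≤ 2 * (N : ℝ) := by
    have h2N : 0 < 2 * N := Nat.mul_pos two_pos (Nat.pos_of_ne_zero (NeZero.ne N))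
    exact_mod_cast Nat.le_of_dvd h2N hdvd
  have hR0 : (0 : ℝ) ≤ ((radical (a * b * (a + b)).natAbs : ℕ) : ℝ) := Nat.cast_nonneg _
  have hN0 : (0 : ℝ) ≤ (N : ℝ) := Nat.cast_nonneg N
  calc ((a * b * (a + b)).natAbs : ℝ)
      ≤ max C 0 ^ 3 * ((radical (a * b * (a + b)).natAbs : ℕ) : ℝ) ^ (3 * max κ 0) := h1
    _ ≤ max C 0 ^ 3 * (2 * (N : ℝ)) ^ (3 * max κ 0) :=
        mul_le_mul_of_nonneg_left (Real.rpow_le_rpow hR0 hRle hκ0) (by positivity)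
    _ = max C 0 ^ 3 * (2 : ℝ) ^ (3 * max κ 0) * (N : ℝ) ^ (3 * max κ 0) := by
        rw [Real.mul_rpow (by norm_num) hN0]; ring

/-- At the primes of an odd `N⁻`, `∏_{q ∣ N⁻} v_q(Δ_min(E_{a,b})) ≤ ∏_{q ∣ N⁻} v_q((ab(a+b))²)`:
factorwise `v_q(Δ_min) ≤ 2 v_q(ab(a+b))` at odd `q` (`factorization_minimalDiscriminantNorm_freyCurve_le`,
the model (12.17) is minimal at odd primes). [folklore] -/
theorem prod_factorization_le_prod_factorization_sq {a b : ℤ} (hab : IsCoprime a b)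
    (h0 : a * b * (a + b) ≠ 0) {Nm : ℕ} (hodd : Odd Nm) :
    ∏ q ∈ Nm.primeFactors, ((freyCurve a b).minimalDiscriminantNorm ℤ).factorization q ≤
      ∏ q ∈ Nm.primeFactors, ((a * b * (a + b)).natAbs ^ 2).factorization q := by
  refine Finset.prod_le_prod' fun q hq => ?_
  have hqp : q.Prime := Nat.prime_of_mem_primeFactors hq
  have hq2 : q ≠ 2 := by
    rintro rfl
    exact (Nat.not_even_iff_odd.mpr hodd) (even_iff_two_dvd.mpr (Nat.dvd_of_mem_primeFactors hq))
  rw [Nat.factorization_pow, Finsupp.smul_apply, smul_eq_mul]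
  exact DefiniteXiPolyFreyDegree.factorization_minimalDiscriminantNorm_freyCurve_le hab h0 hqp hq2

/-- **(H₁) Under `PolyFreyDegree` the level-lowering factor is `≤ C_ε N^ε`.**  For every `ε > 0` there is
`C` with `∏_{q ∣ N⁻} v_q(Δ_min(E_{a,b})) ≤ C · N^ε` for all coprime `a, b` (`ab(a+b) ≠ 0`), `N` the
conductor, and every ODD `N⁻` (no divisibility or admissibility needed).  Proof: `|ab(a+b)| ≤ M N^K`
(`natAbs_le_rpow_conductor_of_polyFreyDegree`), `∏ v_q(Δ_min) ≤ ∏ v_q(n²)` with `n = |ab(a+b)|`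
(`prod_factorization_le_prod_factorization_sq`), and the valuation product of an integer is sub-polynomial,
`∏_{q ∈ S} v_q(n²) ≤ A_δ (n²)^δ` (`stub_valuationProductBound`), with `δ = ε / (2K + 2)`. [folklore] -/
theorem prod_factorization_le_rpow_of_polyFreyDegree (hP : PolyFreyDegree) :
    ∀ ε : ℝ, 0 < ε → ∃ C : ℝ, ∀ a b : ℤ, IsCoprime a b → a * b * (a + b) ≠ 0 → ∀ (N : ℕ) [NeZero N],
      (freyCurve a b).conductorNorm ℤ = N → ∀ Nm : ℕ, Odd Nm →
        ∏ q ∈ Nm.primeFactors, ((((freyCurve a b).minimalDiscriminantNorm ℤ).factorization q : ℕ) : ℝ) ≤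
          C * (N : ℝ) ^ ε := by
  intro ε hε
  obtain ⟨K, M, hK, hM, hn⟩ := natAbs_le_rpow_conductor_of_polyFreyDegree hP
  have hδ : 0 < ε / (2 * K + 2) := div_pos hε (by linarith)
  obtain ⟨A, hA⟩ := Summit.ABC.ABC.Theorems.stub_valuationProductBound (ε / (2 * K + 2)) hδ
  refine ⟨max A 0 * (M ^ 2) ^ (ε / (2 * K + 2)), fun a b hab h0 N _ hN Nm hodd => ?_⟩
  set n : ℕ := (a * b * (a + b)).natAbs with hndef
  have hn0 : n ≠ 0 := Int.natAbs_ne_zero.mpr h0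
  have hn2 : n ^ 2 ≠ 0 := pow_ne_zero 2 hn0
  have hN1 : (1 : ℝ) ≤ (N : ℝ) := Nat.one_le_cast.mpr (Nat.one_le_iff_ne_zero.mpr (NeZero.ne N))
  have hN0 : (0 : ℝ) ≤ (N : ℝ) := zero_le_one.trans hN1
  have hprimes : ∀ q ∈ Nm.primeFactors, q.Prime := fun q hq => Nat.prime_of_mem_primeFactors hq
  -- step 1: compare with the valuation product of `n²`
  have h1 : ∏ q ∈ Nm.primeFactors, ((((freyCurve a b).minimalDiscriminantNorm ℤ).factorization q : ℕ) : ℝ) ≤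
      ((∏ q ∈ Nm.primeFactors, (n ^ 2).factorization q : ℕ) : ℝ) := by
    rw [← Nat.cast_prod]
    exact_mod_cast prod_factorization_le_prod_factorization_sq hab h0 hodd
  -- step 2: sub-polynomial valuation product of `n²`
  have h2 : ((∏ q ∈ Nm.primeFactors, (n ^ 2).factorization q : ℕ) : ℝ) ≤
      A * ((n ^ 2 : ℕ) : ℝ) ^ (ε / (2 * K + 2)) := hA (n ^ 2) hn2 _ hprimes
  -- step 3: `n² ≤ M² N^{2K}`
  have hnle : (n : ℝ) ≤ M * (N : ℝ) ^ K := hn a b hab h0 N hN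
  have hsq : ((n ^ 2 : ℕ) : ℝ) ≤ M ^ 2 * (N : ℝ) ^ (2 * K) := by
    push_cast
    calc (n : ℝ) ^ 2 ≤ (M * (N : ℝ) ^ K) ^ 2 := pow_le_pow_left₀ (Nat.cast_nonneg n) hnle 2
      _ = M ^ 2 * ((N : ℝ) ^ K) ^ 2 := mul_pow _ _ 2
      _ = M ^ 2 * (N : ℝ) ^ (2 * K) := by
          rw [← Real.rpow_natCast ((N : ℝ) ^ K) 2, ← Real.rpow_mul hN0, mul_comm K]
          norm_num
  have hsq0 : (0 : ℝ) ≤ ((n ^ 2 : ℕ) : ℝ) := Nat.cast_nonneg _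
  -- step 4: exponents
  have hexp : 2 * K * (ε / (2 * K + 2)) ≤ ε := by
    rw [mul_div_assoc']
    rw [div_le_iff₀ (by linarith)]
    nlinarith
  have hpow : ((n ^ 2 : ℕ) : ℝ) ^ (ε / (2 * K + 2)) ≤ (M ^ 2) ^ (ε / (2 * K + 2)) * (N : ℝ) ^ ε :=
    calc ((n ^ 2 : ℕ) : ℝ) ^ (ε / (2 * K + 2))
        ≤ (M ^ 2 * (N : ℝ) ^ (2 * K)) ^ (ε / (2 * K + 2)) := Real.rpow_le_rpow hsq0 hsq hδ.le
      _ = (M ^ 2) ^ (ε / (2 * K + 2)) * (N : ℝ) ^ (2 * K * (ε / (2 * K + 2))) := by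
          rw [Real.mul_rpow (sq_nonneg M) (Real.rpow_nonneg hN0 _), ← Real.rpow_mul hN0]
      _ ≤ (M ^ 2) ^ (ε / (2 * K + 2)) * (N : ℝ) ^ ε :=
          mul_le_mul_of_nonneg_left (Real.rpow_le_rpow_of_exponent_le hN1 hexp)
            (Real.rpow_nonneg (sq_nonneg M) _)
  calc ∏ q ∈ Nm.primeFactors, ((((freyCurve a b).minimalDiscriminantNorm ℤ).factorization q : ℕ) : ℝ)
      ≤ A * ((n ^ 2 : ℕ) : ℝ) ^ (ε / (2 * K + 2)) := h1.trans h2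
    _ ≤ max A 0 * ((n ^ 2 : ℕ) : ℝ) ^ (ε / (2 * K + 2)) :=
        mul_le_mul_of_nonneg_right (le_max_left _ _) (Real.rpow_nonneg hsq0 _)
    _ ≤ max A 0 * ((M ^ 2) ^ (ε / (2 * K + 2)) * (N : ℝ) ^ ε) :=
        mul_le_mul_of_nonneg_left hpow (le_max_right _ _)
    _ = max A 0 * (M ^ 2) ^ (ε / (2 * K + 2)) * (N : ℝ) ^ ε := by ring

/-- **(H₂) The sharp `ξ`-bound gives the weak rung** (`A := 3`). [folklore] -/
theorem xiBound_of_xiSharpBound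
    (hS : ∀ ε : ℝ, 0 < ε → ∃ C : ℝ, ∀ a b : ℤ, IsCoprime a b → a * b * (a + b) ≠ 0 → ∀ (N : ℕ) [NeZero N],
      (freyCurve a b).conductorNorm ℤ = N → ∀ Nm : ℕ, Odd Nm → Squarefree Nm →
      Odd Nm.primeFactors.card → Nm ∣ N →
        (brandtXi (N / Nm) Nm (fun n => (freyCurve a b).LFunction n) : ℝ) ≤ C * (N : ℝ) ^ (2 + ε)) :
    XiBound := by
  obtain ⟨C, hC⟩ := hS 1 one_pos
  exact ⟨2 + 1, C, fun a b hab h0 N _ hN Nm h1 h2 h3 h4 => hC a b hab h0 N hN Nm h1 h2 h3 h4⟩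

/-- **(H₃) The strong rung gives the sharp `ξ`-bound** (drop the factor `∏ v_q ≥ 1`). [folklore] -/
theorem xiSharpBound_of_xiStrongBound (h : XiStrongBound) :
    ∀ ε : ℝ, 0 < ε → ∃ C : ℝ, ∀ a b : ℤ, IsCoprime a b → a * b * (a + b) ≠ 0 → ∀ (N : ℕ) [NeZero N],
      (freyCurve a b).conductorNorm ℤ = N → ∀ Nm : ℕ, Odd Nm → Squarefree Nm →
      Odd Nm.primeFactors.card → Nm ∣ N →
        (brandtXi (N / Nm) Nm (fun n => (freyCurve a b).LFunction n) : ℝ) ≤ C * (N : ℝ) ^ (2 + ε) := by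
  intro ε hε
  obtain ⟨C, hC⟩ := h ε hε
  refine ⟨C, fun a b hab h0 N _ hN Nm h1 h2 h3 h4 => ?_⟩
  have hprod := DefiniteXiXiBoundUpgrade.one_le_prod_factorization_minimalDiscriminantNorm_freyCurve h0 hN h4
  exact (le_mul_of_one_le_right (Nat.cast_nonneg _) hprod).trans (hC a b hab h0 N hN Nm h1 h2 h3 h4)

/-- **(H₄) Under `PolyFreyDegree`, the sharp `ξ`-bound gives the strong rung**: at `ε/2` each,
`ξ · ∏ v_q ≤ C₁ N^{2+ε/2} · C₂ N^{ε/2}` by (H₁). [folklore] -/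
theorem xiStrongBound_of_polyFreyDegree_of_xiSharpBound (hP : PolyFreyDegree)
    (hS : ∀ ε : ℝ, 0 < ε → ∃ C : ℝ, ∀ a b : ℤ, IsCoprime a b → a * b * (a + b) ≠ 0 → ∀ (N : ℕ) [NeZero N],
      (freyCurve a b).conductorNorm ℤ = N → ∀ Nm : ℕ, Odd Nm → Squarefree Nm →
      Odd Nm.primeFactors.card → Nm ∣ N →
        (brandtXi (N / Nm) Nm (fun n => (freyCurve a b).LFunction n) : ℝ) ≤ C * (N : ℝ) ^ (2 + ε)) :
    XiStrongBound := by
  intro ε hε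
  have hε2 : 0 < ε / 2 := by positivity
  obtain ⟨C₁, hC₁⟩ := hS (ε / 2) hε2
  obtain ⟨C₂, hC₂⟩ := prod_factorization_le_rpow_of_polyFreyDegree hP (ε / 2) hε2
  refine ⟨max C₁ 0 * max C₂ 0, fun a b hab h0 N _ hN Nm ho hs hc hd => ?_⟩
  have hN0 : (0 : ℝ) ≤ (N : ℝ) := Nat.cast_nonneg N
  have hNpos : (0 : ℝ) < (N : ℝ) := Nat.cast_pos.mpr (Nat.pos_of_ne_zero (NeZero.ne N))
  have hξ : (brandtXi (N / Nm) Nm (fun n => (freyCurve a b).LFunction n) : ℝ) ≤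
      max C₁ 0 * (N : ℝ) ^ (2 + ε / 2) :=
    (hC₁ a b hab h0 N hN Nm ho hs hc hd).trans
      (mul_le_mul_of_nonneg_right (le_max_left _ _) (Real.rpow_nonneg hN0 _))
  have hprod : ∏ q ∈ Nm.primeFactors,
      ((((freyCurve a b).minimalDiscriminantNorm ℤ).factorization q : ℕ) : ℝ) ≤
        max C₂ 0 * (N : ℝ) ^ (ε / 2) :=
    (hC₂ a b hab h0 N hN Nm ho).trans
      (mul_le_mul_of_nonneg_right (le_max_left _ _) (Real.rpow_nonneg hN0 _))
  calc (brandtXi (N / Nm) Nm (fun n => (freyCurve a b).LFunction n) : ℝ) *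
        ∏ q ∈ Nm.primeFactors, ((((freyCurve a b).minimalDiscriminantNorm ℤ).factorization q : ℕ) : ℝ)
      ≤ (max C₁ 0 * (N : ℝ) ^ (2 + ε / 2)) * (max C₂ 0 * (N : ℝ) ^ (ε / 2)) :=
        mul_le_mul hξ hprod (Finset.prod_nonneg fun _ _ => Nat.cast_nonneg _)
          (mul_nonneg (le_max_right _ _) (Real.rpow_nonneg hN0 _))
    _ = max C₁ 0 * max C₂ 0 * ((N : ℝ) ^ (2 + ε / 2) * (N : ℝ) ^ (ε / 2)) := by ring
    _ = max C₁ 0 * max C₂ 0 * (N : ℝ) ^ (2 + ε) := by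
        rw [← Real.rpow_add hNpos]; congr 1; ring_nf

/-- **(H₅) Given `PolyFreyDegree`, the r4 crux is the product-free sharp `ξ`-bound**:
`XiStrongBound ↔ ∀ ε ∃ C, ξ(E_{a,b}; N/N⁻, N⁻) ≤ C N^{2+ε}` (admissible `N⁻`). [folklore] -/
theorem xiStrongBound_iff_xiSharpBound_of_polyFreyDegree (hP : PolyFreyDegree) :
    XiStrongBound ↔
      ∀ ε : ℝ, 0 < ε → ∃ C : ℝ, ∀ a b : ℤ, IsCoprime a b → a * b * (a + b) ≠ 0 → ∀ (N : ℕ) [NeZero N],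
        (freyCurve a b).conductorNorm ℤ = N → ∀ Nm : ℕ, Odd Nm → Squarefree Nm →
        Odd Nm.primeFactors.card → Nm ∣ N →
          (brandtXi (N / Nm) Nm (fun n => (freyCurve a b).LFunction n) : ℝ) ≤ C * (N : ℝ) ^ (2 + ε) :=
  ⟨xiSharpBound_of_xiStrongBound, xiStrongBound_of_polyFreyDegree_of_xiSharpBound hP⟩

/-- **(H₆) Given the three KNOWN inputs, the r4 crux is the product-free sharp `ξ`-bound.**
With `DefiniteRTControlPrime` (stmt-ABC-11338, Takahashi 2001 / Pasten Thm 6.1), the valuation bound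
`v_q(Δ_min) ≤ K N^B` at odd primes `q ∣ N` (Stewart–Tijdeman 1986; the former item `FreyValuationBound`,
landed conditionally as `freyValuationBound_of_stewartTijdeman`) and `FreyModularity` (stmt-ABC-11340,
Wiles / BCDT): `XiStrongBound ↔ ∀ ε ∃ C, ξ ≤ C N^{2+ε}`.  (`PolyFreyDegree` comes for free from either
side via `XiBound`, `polyFreyDegree_of_xiBound_of_valuationBound`.)  So the level-lowering factor
`∏_{q ∣ N⁻} v_q(Δ_min)` and Pasten's product theorem are not load-bearing in the r4 crux. [folklore] -/
theorem xiStrongBound_iff_xiSharpBound (hRT : DefiniteRTControlPrime)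
    (hval : ∃ B K : ℝ, ∀ a b : ℤ, IsCoprime a b → a * b * (a + b) ≠ 0 → ∀ (N : ℕ) [NeZero N],
      (freyCurve a b).conductorNorm ℤ = N → ∀ q : ℕ, q.Prime → q ≠ 2 → q ∣ N →
        ((((freyCurve a b).minimalDiscriminantNorm ℤ).factorization q : ℕ) : ℝ) ≤ K * (N : ℝ) ^ B)
    (hMod : FreyModularity) :
    XiStrongBound ↔
      ∀ ε : ℝ, 0 < ε → ∃ C : ℝ, ∀ a b : ℤ, IsCoprime a b → a * b * (a + b) ≠ 0 → ∀ (N : ℕ) [NeZero N],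
        (freyCurve a b).conductorNorm ℤ = N → ∀ Nm : ℕ, Odd Nm → Squarefree Nm →
        Odd Nm.primeFactors.card → Nm ∣ N →
          (brandtXi (N / Nm) Nm (fun n => (freyCurve a b).LFunction n) : ℝ) ≤ C * (N : ℝ) ^ (2 + ε) :=
  ⟨xiSharpBound_of_xiStrongBound, fun hS =>
    xiStrongBound_of_polyFreyDegree_of_xiSharpBound
      (DefiniteXiPolyFreyDegree.polyFreyDegree_of_xiBound_of_valuationBound (xiBound_of_xiSharpBound hS)
        hRT hval hMod) hS⟩

/-- **(H₇) The item as the exponent sharpening of `ξ` alone.**  Given the three known inputs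
`DefiniteRTControlPrime`, the odd-prime valuation bound, `FreyModularity`:
`XiBoundUpgrade ↔ (XiBound → ∀ ε ∃ C, ξ(E_{a,b}; N/N⁻, N⁻) ≤ C N^{2+ε})` — i.e. the support item is
exactly "`ξ ≤ C N^A` for SOME absolute `A` implies `ξ ≤ C_ε N^{2+ε}` for EVERY `ε > 0`", the sharpening
of the exponent of the definite congruence number (abc-strength: with `DefiniteRTControlPrime` the right
side gives Frey's degree conjecture; `A ≥ 2` is forced by Masser 1990). [folklore] -/
theorem xiBoundUpgrade_iff_xiSharpening (hRT : DefiniteRTControlPrime)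
    (hval : ∃ B K : ℝ, ∀ a b : ℤ, IsCoprime a b → a * b * (a + b) ≠ 0 → ∀ (N : ℕ) [NeZero N],
      (freyCurve a b).conductorNorm ℤ = N → ∀ q : ℕ, q.Prime → q ≠ 2 → q ∣ N →
        ((((freyCurve a b).minimalDiscriminantNorm ℤ).factorization q : ℕ) : ℝ) ≤ K * (N : ℝ) ^ B)
    (hMod : FreyModularity) :
    XiBoundUpgrade ↔
      (XiBound → ∀ ε : ℝ, 0 < ε → ∃ C : ℝ, ∀ a b : ℤ, IsCoprime a b → a * b * (a + b) ≠ 0 →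
        ∀ (N : ℕ) [NeZero N], (freyCurve a b).conductorNorm ℤ = N → ∀ Nm : ℕ, Odd Nm → Squarefree Nm →
        Odd Nm.primeFactors.card → Nm ∣ N →
          (brandtXi (N / Nm) Nm (fun n => (freyCurve a b).LFunction n) : ℝ) ≤ C * (N : ℝ) ^ (2 + ε)) :=
  ⟨fun hU hXi => xiSharpBound_of_xiStrongBound (hU hXi), fun h hXi =>
    xiStrongBound_of_polyFreyDegree_of_xiSharpBound
      (DefiniteXiPolyFreyDegree.polyFreyDegree_of_xiBound_of_valuationBound hXi hRT hval hMod) (h hXi)⟩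

/-- **(H₈) The same with `PolyFreyDegree` as the only side hypothesis** (the weak rung's GL₂ avatar,
stmt-ABC-2026): `XiBoundUpgrade ↔ (XiBound → sharp ξ-bound)`. [folklore] -/
theorem xiBoundUpgrade_iff_xiSharpening_of_polyFreyDegree (hP : PolyFreyDegree) :
    XiBoundUpgrade ↔
      (XiBound → ∀ ε : ℝ, 0 < ε → ∃ C : ℝ, ∀ a b : ℤ, IsCoprime a b → a * b * (a + b) ≠ 0 →
        ∀ (N : ℕ) [NeZero N], (freyCurve a b).conductorNorm ℤ = N → ∀ Nm : ℕ, Odd Nm → Squarefree Nm →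
        Odd Nm.primeFactors.card → Nm ∣ N →
          (brandtXi (N / Nm) Nm (fun n => (freyCurve a b).LFunction n) : ℝ) ≤ C * (N : ℝ) ^ (2 + ε)) :=
  ⟨fun hU hXi => xiSharpBound_of_xiStrongBound (hU hXi),
    fun h hXi => xiStrongBound_of_polyFreyDegree_of_xiSharpBound hP (h hXi)⟩

end Summit.ABC.ABC.Theorems.DefiniteXiXiBoundUpgradeSharpening

end
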